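import Literature.Probability.LatticeModels.ChessboardEstimateEvenTorus
import HarnessLib

/-!
# The chessboard estimate for label assignments on an even block torus
# (Fröhlich–Israel–Lieb–Simon 1978, Theorems 4.1/4.3)

The tree files `Literature/Barriers/CriticalPhenomena/PositionSpaceRGNonGibbsianChessboard.lean`
and `Literature/Probability/LatticeModels/ChessboardEstimateEvenTorus.lean` prove the chessboard
estimate of Fröhlich–Israel–Lieb–Simon for SET functions on the block torus `(ℤ/Nℤ)^d`
(`BlockIdx d N = Fin d → ZMod N`): `ψ S ^ (N^d) ≤ ψ univ ^ #S` — every block carries the SAME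
observable ("bad block") or the unit. This file proves the estimate for GENERAL LABEL ASSIGNMENTS
`σ : BlockIdx d N → ι` (block `c` carries the observable with label `σ c`), which is the form of
FILS 1978 Thm. 4.1 (abstract chessboard estimate, `2n` possibly different arguments) / Thm. 4.3
(even torus, reflections in all coordinate hyperplanes between blocks), Biskup 2009 Thm. 5.8,
Friedli–Velenik 2017 Thm. 10.11:

* `asgSymP i k σ`, `asgSymM i k σ`: the two reflection symmetrisations of an assignment through
  the block boundaries `k`, `k + N/2` in direction `i` — keep the labels of the positive half
  `halfPlus N i k` (resp. the negative half `halfMinus N i k`) and mirror them into the other half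
  by the block reflection `cellReflect i k : c ↦ c[i ↦ 2k - 1 - cᵢ]`: the assignments carried by
  `F · ΘF` and `ΘG · G` in the reflection Cauchy–Schwarz inequality `⟨F ΘG⟩² ≤ ⟨F ΘF⟩ ⟨G ΘG⟩`.
  On preimages they are the tree's set symmetrisations `symP`, `symM` (`filter_asgSymP_eq_symP`).
* **`chessboard_abs_pow_le_prod_const`**: if `0 < d`, `N` is even, and a real functional `ψ` of
  assignments satisfies, for every direction `i`, boundary `k` and assignment `σ`,
  `0 ≤ ψ (asgSymP i k σ)`, `0 ≤ ψ (asgSymM i k σ)` (reflection positivity) and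
  `ψ σ ^ 2 ≤ ψ (asgSymP i k σ) * ψ (asgSymM i k σ)` (reflection Cauchy–Schwarz), then
  `|ψ σ| ^ (N^d) ≤ ∏_c ψ (const (σ c))` for every `σ`. In the application
  `ψ σ = ⟨∏_c f_{σ c}(block c)⟩` and `ψ (const a) ^ (1/N^d)` is the seminorm `‖f_a‖` of FILS (4.3) /
  Friedli–Velenik (10.20).

Proof (FILS 1978, proof of Thm. 4.1, followed literally): the combinatorial core
`good_const_of_asgSym_stable` — a property of assignments stable under all `asgSymP i k`,
`asgSymM i k` passes from `τ₀` to the CONSTANT assignment with value any letter `τ₀ t₀`: runs of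
`1, 2, …, 2^J` blocks along an axis on which the assignment is constant are doubled by `asgSymM`
through the boundary ending the run (`mem_axisRun_succ`, `axisRun_subset_halfMinus` of the tree),
the last one (`2^J ≤ N < 2^(J+1)`) is completed to the full line by `asgSymP` through the boundary
starting it; then the next axis (`boxRun`). Positive case (all `ψ (const a) > 0`, finite `ι`):
maximise `g τ = |ψ τ| ^ (N^d) / ∏_c ψ (const (τ c))`; `g` inherits the Cauchy–Schwarz inequality
(`prod_asgSymP_mul_prod_asgSymM`), so both symmetrisations of a maximiser are maximisers, hence a
constant assignment is a maximiser, where `g = 1`. Zero case (some `ψ (const (σ t₀)) = 0`):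
`ψ τ ≠ 0` is stable by Cauchy–Schwarz, so `ψ σ ≠ 0` would force `ψ (const (σ t₀)) ≠ 0`. A general
label type is reduced to the finite label type `BlockIdx d N` by pulling `ψ` back along `σ`
(`asgSymP_comp`); no `ε`-regularisation or limit is needed. The doubling bookkeeping is adapted
from the letter-form proof (abstract symmetrisation operators) in the Theorems file
`Summits/QuantumFields/QCD/Theorems/QuarksAsStableActionUnquenchedChessboardBoundStubChessboardAux`.

Design: `d = 0` is excluded in the main theorem (no reflection; the hypotheses are void and
`|ψ σ| ≤ ψ σ` fails for `ψ < 0`); `N = 0` by `[NeZero N]`; `N = 2` is allowed. No named facts.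

## References

* J. Fröhlich, R. Israel, E. H. Lieb, B. Simon, *Phase transitions and reflection positivity. I*,
  Comm. Math. Phys. 62 (1978) 1–34, Thms. 4.1 (abstract), 4.3 [FrohlichIsraelLiebSimon1978].
* M. Biskup, *Reflection positivity and phase transitions in lattice spin models*, LNM 1970
  (2009), Thm. 5.8 [Biskup2009].
* S. Friedli, Y. Velenik, *Statistical Mechanics of Lattice Systems*, CUP 2017, Thm. 10.11
  [FriedliVelenik2017].
-/

noncomputable section

namespace Literature.Probability.LatticeModels

open Finset
open Literature.Barriers.CriticalPhenomena.NonGibbs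

variable {d N : ℕ} [NeZero N] {ι κ : Type*}

/-! ### Reflection symmetrisations of label assignments -/

/-- **Positive symmetrisation of a label assignment** `σ : (ℤ/N)^d → ι` through the block
boundaries `k`, `k + N/2` in direction `i`: keep the labels of the positive half
`H₊ = {(cᵢ - k).val < N/2}` and mirror them into the negative half (`c ↦ σ (θ c)` there). The
assignment carried by `F · ΘF`, `F = ∏_{c ∈ H₊} f_{σ c}(block c)`, in the reflection Cauchy–Schwarz
step of the chessboard estimate. [cite: FrohlichIsraelLiebSimon1978, Thm 4.1 (proof)] -/
def asgSymP (i : Fin d) (k : ZMod N) (σ : BlockIdx d N → ι) : BlockIdx d N → ι :=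
  fun c => if c ∈ halfPlus N i k then σ c else σ (cellReflect i k c)

/-- **Negative symmetrisation of a label assignment**: keep the labels of the negative half
`H₋ = {N/2 ≤ (cᵢ - k).val}` and mirror them into the positive half.
[cite: FrohlichIsraelLiebSimon1978, Thm 4.1 (proof)] -/
def asgSymM (i : Fin d) (k : ZMod N) (σ : BlockIdx d N → ι) : BlockIdx d N → ι :=
  fun c => if c ∈ halfMinus N i k then σ c else σ (cellReflect i k c)

/-- A constant assignment is fixed by every positive symmetrisation. [folklore] -/
@[simp] theorem asgSymP_const (i : Fin d) (k : ZMod N) (a : ι) :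
    asgSymP i k (fun _ : BlockIdx d N => a) = fun _ => a := by
  funext c; simp [asgSymP]

/-- A constant assignment is fixed by every negative symmetrisation. [folklore] -/
@[simp] theorem asgSymM_const (i : Fin d) (k : ZMod N) (a : ι) :
    asgSymM i k (fun _ : BlockIdx d N => a) = fun _ => a := by
  funext c; simp [asgSymM]

/-- On the positive half the positive symmetrisation keeps the label. [folklore] -/
theorem asgSymP_apply_of_mem {i : Fin d} {k : ZMod N} (σ : BlockIdx d N → ι) {c : BlockIdx d N}
    (hc : c ∈ halfPlus N i k) : asgSymP i k σ c = σ c := if_pos hc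

/-- Off the positive half the positive symmetrisation takes the mirrored label. [folklore] -/
theorem asgSymP_apply_of_not_mem {i : Fin d} {k : ZMod N} (σ : BlockIdx d N → ι)
    {c : BlockIdx d N} (hc : c ∉ halfPlus N i k) : asgSymP i k σ c = σ (cellReflect i k c) :=
  if_neg hc

/-- On the negative half the negative symmetrisation keeps the label. [folklore] -/
theorem asgSymM_apply_of_mem {i : Fin d} {k : ZMod N} (σ : BlockIdx d N → ι) {c : BlockIdx d N}
    (hc : c ∈ halfMinus N i k) : asgSymM i k σ c = σ c := if_pos hc

/-- Off the negative half the negative symmetrisation takes the mirrored label. [folklore] -/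
theorem asgSymM_apply_of_not_mem {i : Fin d} {k : ZMod N} (σ : BlockIdx d N → ι)
    {c : BlockIdx d N} (hc : c ∉ halfMinus N i k) : asgSymM i k σ c = σ (cellReflect i k c) :=
  if_neg hc

/-- A block of the positive half is not in the negative half. [folklore] -/
theorem not_mem_halfMinus_of_mem_halfPlus {i : Fin d} {k : ZMod N} {c : BlockIdx d N}
    (hc : c ∈ halfPlus N i k) : c ∉ halfMinus N i k :=
  fun h => Finset.disjoint_left.1 (disjoint_halfPlus_halfMinus i k) hc h

/-- A block not in the positive half is in the negative half. [folklore] -/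
theorem mem_halfMinus_of_not_mem_halfPlus {i : Fin d} {k : ZMod N} {c : BlockIdx d N}
    (hc : c ∉ halfPlus N i k) : c ∈ halfMinus N i k :=
  (mem_halfPlus_or_mem_halfMinus i k c).resolve_left hc

/-- Relabelling commutes with the positive symmetrisation: `asgSymP (f ∘ σ) = f ∘ asgSymP σ`.
[folklore] -/
theorem asgSymP_comp (i : Fin d) (k : ZMod N) (f : ι → κ) (σ : BlockIdx d N → ι) :
    asgSymP i k (f ∘ σ) = f ∘ asgSymP i k σ := by
  funext c
  by_cases hc : c ∈ halfPlus N i k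
  · rw [Function.comp_apply, asgSymP_apply_of_mem _ hc, asgSymP_apply_of_mem _ hc]; rfl
  · rw [Function.comp_apply, asgSymP_apply_of_not_mem _ hc, asgSymP_apply_of_not_mem _ hc]; rfl

/-- Relabelling commutes with the negative symmetrisation: `asgSymM (f ∘ σ) = f ∘ asgSymM σ`.
[folklore] -/
theorem asgSymM_comp (i : Fin d) (k : ZMod N) (f : ι → κ) (σ : BlockIdx d N → ι) :
    asgSymM i k (f ∘ σ) = f ∘ asgSymM i k σ := by
  funext c
  by_cases hc : c ∈ halfMinus N i k
  · rw [Function.comp_apply, asgSymM_apply_of_mem _ hc, asgSymM_apply_of_mem _ hc]; rfl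
  · rw [Function.comp_apply, asgSymM_apply_of_not_mem _ hc, asgSymM_apply_of_not_mem _ hc]; rfl

/-- **On preimages the positive symmetrisation of assignments is the tree's set symmetrisation**
`symP`: `(asgSymP i k σ)⁻¹{a} = symP i k (σ⁻¹{a}) = (σ⁻¹{a} ∩ H₊) ∪ θ(σ⁻¹{a} ∩ H₊)` (even `N`).
[folklore] -/
theorem filter_asgSymP_eq_symP [DecidableEq ι] (hN : Even N) (i : Fin d) (k : ZMod N)
    (σ : BlockIdx d N → ι) (a : ι) :
    (univ.filter fun c => asgSymP i k σ c = a) = symP i k (univ.filter fun c => σ c = a) := by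
  ext c
  simp only [mem_filter, mem_univ, true_and, symP, mem_union, mem_inter, mem_image]
  by_cases hc : c ∈ halfPlus N i k
  · rw [asgSymP_apply_of_mem _ hc]
    refine ⟨fun h => Or.inl ⟨h, hc⟩, ?_⟩
    rintro (⟨h, -⟩ | ⟨c', ⟨-, hc'⟩, rfl⟩)
    · exact h
    · exact absurd (cellReflect_mem_halfMinus hN hc') (not_mem_halfMinus_of_mem_halfPlus hc)
  · rw [asgSymP_apply_of_not_mem _ hc]
    refine ⟨fun h => Or.inr ⟨_, ⟨h, cellReflect_mem_halfPlus hN (mem_halfMinus_of_not_mem_halfPlus hc)⟩,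
      cellReflect_cellReflect i k c⟩, ?_⟩
    rintro (⟨-, h⟩ | ⟨c', ⟨h, -⟩, rfl⟩)
    · exact absurd h hc
    · rwa [cellReflect_cellReflect]

/-- **On preimages the negative symmetrisation of assignments is the tree's `symM`**:
`(asgSymM i k σ)⁻¹{a} = symM i k (σ⁻¹{a})` (even `N`). [folklore] -/
theorem filter_asgSymM_eq_symM [DecidableEq ι] (hN : Even N) (i : Fin d) (k : ZMod N)
    (σ : BlockIdx d N → ι) (a : ι) :
    (univ.filter fun c => asgSymM i k σ c = a) = symM i k (univ.filter fun c => σ c = a) := by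
  ext c
  simp only [mem_filter, mem_univ, true_and, symM, mem_union, mem_inter, mem_image]
  by_cases hc : c ∈ halfMinus N i k
  · rw [asgSymM_apply_of_mem _ hc]
    refine ⟨fun h => Or.inl ⟨h, hc⟩, ?_⟩
    rintro (⟨h, -⟩ | ⟨c', ⟨-, hc'⟩, rfl⟩)
    · exact h
    · exact absurd hc (not_mem_halfMinus_of_mem_halfPlus (cellReflect_mem_halfPlus hN hc'))
  · rw [asgSymM_apply_of_not_mem _ hc]
    have hc' : c ∈ halfPlus N i k := (mem_halfPlus_or_mem_halfMinus i k c).resolve_right hc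
    refine ⟨fun h => Or.inr ⟨_, ⟨h, cellReflect_mem_halfMinus hN hc'⟩, cellReflect_cellReflect i k c⟩,
      ?_⟩
    rintro (⟨-, h⟩ | ⟨c', ⟨h, -⟩, rfl⟩)
    · exact absurd h hc
    · rwa [cellReflect_cellReflect]

/-- **The weights of the two symmetrised assignments multiply to the square of the weight**:
`∏_c ν((asgSymP τ) c) · ∏_c ν((asgSymM τ) c) = (∏_c ν(τ c))²` — blockwise the two factors are
`ν (τ c)` and `ν (τ (θ c))` in some order, and `θ` is a bijection (the set version's
`#symP S + #symM S = 2 #S`). [cite: FrohlichIsraelLiebSimon1978, Thm 4.1 (proof)] -/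
theorem prod_asgSymP_mul_prod_asgSymM {M : Type*} [CommMonoid M] (ν : ι → M) (i : Fin d)
    (k : ZMod N) (τ : BlockIdx d N → ι) :
    (∏ c, ν (asgSymP i k τ c)) * ∏ c, ν (asgSymM i k τ c) = (∏ c, ν (τ c)) ^ 2 := by
  rw [← prod_mul_distrib]
  have h : ∀ c, ν (asgSymP i k τ c) * ν (asgSymM i k τ c) =
      ν (τ c) * ν (τ (cellReflect i k c)) := by
    intro c
    by_cases hc : c ∈ halfPlus N i k
    · rw [asgSymP_apply_of_mem _ hc,
        asgSymM_apply_of_not_mem _ (not_mem_halfMinus_of_mem_halfPlus hc)]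
    · rw [asgSymP_apply_of_not_mem _ hc,
        asgSymM_apply_of_mem _ (mem_halfMinus_of_not_mem_halfPlus hc), mul_comm]
  simp_rw [h]
  rw [prod_mul_distrib, sq]
  congr 1
  exact Fintype.prod_equiv (cellReflect i k) _ _ (fun c => rfl)

/-! ### The doubling argument -/

/-- **One axis of the doubling argument.** If a property `Good` of assignments is stable under
all symmetrisations, then from a good assignment constant `= b` on the box of blocks fixed to `t₀`
from axis `i` on one reaches a good assignment constant `= b` on the box fixed from axis `i+1` on:
runs of `2^j` blocks, `2^(j+1) ≤ N`, are doubled by the negative symmetrisation through the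
boundary `t₀ᵢ + 2^j` ending the run, and the last run (`2^J > N/2`) is completed by the positive
symmetrisation through the boundary `t₀ᵢ` starting it.
[cite: FrohlichIsraelLiebSimon1978, Thm 4.1 (proof)] -/
theorem exists_good_const_on_boxRun_succ (hN : Even N) {Good : (BlockIdx d N → ι) → Prop}
    (hP : ∀ (i : Fin d) (k : ZMod N) (τ : BlockIdx d N → ι), Good τ → Good (asgSymP i k τ))
    (hM : ∀ (i : Fin d) (k : ZMod N) (τ : BlockIdx d N → ι), Good τ → Good (asgSymM i k τ))
    (b : ι) (t₀ : BlockIdx d N) (i : Fin d)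
    (h : ∃ τ, Good τ ∧ ∀ c ∈ boxRun t₀ i.val, τ c = b) :
    ∃ τ, Good τ ∧ ∀ c ∈ boxRun t₀ (i.val + 1), τ c = b := by
  have hJ1 : N < 2 ^ Nat.log 2 N * 2 := by
    simpa [pow_succ] using Nat.lt_pow_succ_log_self one_lt_two N
  have hJ2 : 2 ^ Nat.log 2 N ≤ N := Nat.pow_log_le_self 2 (NeZero.ne N)
  -- doublings along axis `i`
  have key : ∀ j, j ≤ Nat.log 2 N → ∃ τ, Good τ ∧ ∀ c ∈ axisRun t₀ i j, τ c = b := by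
    intro j
    induction j with
    | zero => exact fun _ => by rw [axisRun_zero]; exact h
    | succ j ih =>
      intro hj
      obtain ⟨τ, hτ, hrun⟩ := ih (Nat.le_of_succ_le hj)
      have h2 : 2 ^ (j + 1) ≤ N := (Nat.pow_le_pow_right two_pos hj).trans hJ2
      have hj' : 2 ^ j ≤ N / 2 := by rw [pow_succ] at h2; omega
      refine ⟨asgSymM i (t₀ i + ((2 ^ j : ℕ) : ZMod N)) τ, hM _ _ τ hτ, fun c hc => ?_⟩
      rcases mem_axisRun_succ h2 hc with h' | h'
      · rw [asgSymM_apply_of_mem _ (axisRun_subset_halfMinus hj' t₀ i h')]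
        exact hrun c h'
      · have hcp : c ∈ halfPlus N i (t₀ i + ((2 ^ j : ℕ) : ZMod N)) := by
          have := cellReflect_mem_halfPlus hN (axisRun_subset_halfMinus hj' t₀ i h')
          rwa [cellReflect_cellReflect] at this
        rw [asgSymM_apply_of_not_mem _ (not_mem_halfMinus_of_mem_halfPlus hcp)]
        exact hrun _ h'
  -- completing the axis
  obtain ⟨τ, hτ, hrun⟩ := key _ le_rfl
  refine ⟨asgSymP i (t₀ i) τ, hP i (t₀ i) τ hτ, fun c hc => ?_⟩
  rw [mem_boxRun] at hc
  by_cases hci : c ∈ halfPlus N i (t₀ i)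
  · rw [asgSymP_apply_of_mem _ hci]
    have := mem_halfPlus.1 hci
    refine hrun c (mem_axisRun.2 ⟨fun i' hi' => hc i' hi', ?_⟩)
    omega
  · have hmem : cellReflect i (t₀ i) c ∈ axisRun t₀ i (Nat.log 2 N) := by
      rw [mem_axisRun]
      refine ⟨fun i' hi' => ?_, ?_⟩
      · rw [cellReflect_apply_of_ne _ _ _ (fun h => by rw [h] at hi'; exact lt_irrefl _ hi')]
        exact hc i' hi'
      · have := mem_halfPlus.1
          (cellReflect_mem_halfPlus hN (mem_halfMinus_of_not_mem_halfPlus hci))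
        omega
    rw [asgSymP_apply_of_not_mem _ hci]
    exact hrun _ hmem

/-- **The doubling argument** (combinatorial core of the extremal proof of the chessboard
estimate, every even `N`): a property of assignments stable under all symmetrisations passes from
`τ₀` to the constant assignment with value any letter `τ₀ t₀` of `τ₀`.
[cite: FrohlichIsraelLiebSimon1978, Thm 4.1 (proof)] -/
theorem good_const_of_asgSym_stable (hN : Even N) {Good : (BlockIdx d N → ι) → Prop}
    (hP : ∀ (i : Fin d) (k : ZMod N) (τ : BlockIdx d N → ι), Good τ → Good (asgSymP i k τ))
    (hM : ∀ (i : Fin d) (k : ZMod N) (τ : BlockIdx d N → ι), Good τ → Good (asgSymM i k τ))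
    {τ₀ : BlockIdx d N → ι} (h₀ : Good τ₀) (t₀ : BlockIdx d N) : Good (fun _ => τ₀ t₀) := by
  have grow : ∀ m, m ≤ d → ∃ τ, Good τ ∧ ∀ c ∈ boxRun t₀ m, τ c = τ₀ t₀ := by
    intro m
    induction m with
    | zero =>
      refine fun _ => ⟨τ₀, h₀, fun c hc => ?_⟩
      rw [boxRun_zero, mem_singleton] at hc
      rw [hc]
    | succ m ih =>
      exact fun hm =>
        exists_good_const_on_boxRun_succ hN hP hM _ t₀ ⟨m, hm⟩ (ih (Nat.le_of_succ_le hm))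
  obtain ⟨τ, hτ, hall⟩ := grow d le_rfl
  exact (funext fun c => hall c (by rw [boxRun_eq_univ]; exact mem_univ c) : τ = _) ▸ hτ

/-! ### The extremal argument -/

/-- **Zero case.** Under reflection Cauchy–Schwarz, `ψ τ ≠ 0` is stable under symmetrisations,
so an assignment one of whose letters has a constant assignment with `ψ = 0` has `ψ = 0`
(FILS: "if some `‖aᵢ‖ = 0` then `F(a₁, …, a₂ₙ) = 0`").
[cite: FrohlichIsraelLiebSimon1978, Thm 4.1 (proof)] -/
theorem chessboard_eq_zero_of_const_eq_zero (hN : Even N) {ψ : (BlockIdx d N → ι) → ℝ}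
    (hcs : ∀ (i : Fin d) (k : ZMod N) (σ : BlockIdx d N → ι),
      ψ σ ^ 2 ≤ ψ (asgSymP i k σ) * ψ (asgSymM i k σ))
    {σ : BlockIdx d N → ι} {t₀ : BlockIdx d N} (h0 : ψ (fun _ => σ t₀) = 0) : ψ σ = 0 := by
  by_contra hne
  have key : ∀ τ, ψ τ ≠ 0 → ∀ (i : Fin d) (k : ZMod N),
      ψ (asgSymP i k τ) ≠ 0 ∧ ψ (asgSymM i k τ) ≠ 0 := by
    intro τ hτ i k
    have h := hcs i k τ
    have h2 : 0 < ψ τ ^ 2 := by positivity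
    constructor <;> intro h' <;> simp only [h', zero_mul, mul_zero] at h <;> linarith
  exact good_const_of_asgSym_stable hN (Good := fun τ => ψ τ ≠ 0) (fun i k τ hτ => (key τ hτ i k).1)
    (fun i k τ hτ => (key τ hτ i k).2) hne t₀ h0

/-- **Positive case (the extremal argument), finite label type.** If every constant assignment
has `ψ > 0`, then `|ψ σ| ^ (N^d) ≤ ∏_c ψ (const (σ c))`: maximise the ratio
`g τ = |ψ τ| ^ (N^d) / ∏_c ψ (const (τ c))` over all assignments; both symmetrisations of a
maximiser are maximisers (Cauchy–Schwarz and `prod_asgSymP_mul_prod_asgSymM`), so by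
`good_const_of_asgSym_stable` a constant assignment is a maximiser, where the ratio is `1`.
[cite: FrohlichIsraelLiebSimon1978, Thm 4.1 (proof)] -/
theorem chessboard_abs_pow_le_prod_const_of_pos [Finite ι] (hN : Even N)
    (ψ : (BlockIdx d N → ι) → ℝ)
    (h : ∀ (i : Fin d) (k : ZMod N) (σ : BlockIdx d N → ι),
      0 ≤ ψ (asgSymP i k σ) ∧ 0 ≤ ψ (asgSymM i k σ) ∧
        ψ σ ^ 2 ≤ ψ (asgSymP i k σ) * ψ (asgSymM i k σ))
    (hγ : ∀ a : ι, 0 < ψ (fun _ => a)) (σ : BlockIdx d N → ι) :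
    |ψ σ| ^ (N ^ d) ≤ ∏ c, ψ (fun _ => σ c) := by
  have hcard : Fintype.card (BlockIdx d N) = N ^ d := by
    rw [Fintype.card_pi, prod_const, ZMod.card, card_univ, Fintype.card_fin]
  -- the ratio `g`
  obtain ⟨g, hg⟩ : ∃ g : (BlockIdx d N → ι) → ℝ,
      ∀ τ, g τ = |ψ τ| ^ (N ^ d) / ∏ c, ψ (fun _ => τ c) := ⟨_, fun _ => rfl⟩
  have hD : ∀ τ : BlockIdx d N → ι, 0 < ∏ c, ψ (fun _ => τ c) := fun τ =>
    prod_pos fun c _ => hγ _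
  have hg0 : ∀ τ, 0 ≤ g τ := fun τ => by rw [hg]; exact div_nonneg (by positivity) (hD τ).le
  have hg1 : ∀ a : ι, g (fun _ => a) = 1 := fun a => by
    rw [hg, prod_const, card_univ, hcard, abs_of_nonneg (hγ a).le]
    exact div_self (pow_ne_zero _ (hγ a).ne')
  -- Cauchy–Schwarz for the ratio
  have hgcs : ∀ (i : Fin d) (k : ZMod N) (τ : BlockIdx d N → ι),
      g τ ^ 2 ≤ g (asgSymP i k τ) * g (asgSymM i k τ) := by
    intro i k τ
    obtain ⟨hP, hM, hcs⟩ := h i k τ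
    rw [hg, hg, hg, div_pow, div_mul_div_comm,
      prod_asgSymP_mul_prod_asgSymM (fun a => ψ fun _ => a) i k τ]
    refine div_le_div_of_nonneg_right ?_ (by positivity)
    rw [← pow_mul, mul_comm (N ^ d) 2, pow_mul, ← mul_pow]
    refine pow_le_pow_left₀ (sq_nonneg _) ?_ _
    rw [sq_abs, abs_of_nonneg hP, abs_of_nonneg hM]
    exact hcs
  -- a maximiser `τm`; both symmetrisations of a maximiser are maximisers
  haveI : Nonempty (BlockIdx d N → ι) := ⟨σ⟩
  obtain ⟨τm, hmax⟩ := Finite.exists_max g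
  have hG1 : 1 ≤ g τm := by rw [← hg1 (τm 0)]; exact hmax _
  have hGpos : 0 < g τm := one_pos.trans_le hG1
  have hmaxPM : ∀ (i : Fin d) (k : ZMod N) (τ : BlockIdx d N → ι), g τ = g τm →
      g (asgSymP i k τ) = g τm ∧ g (asgSymM i k τ) = g τm := by
    intro i k τ hτ
    have h2 := hτ ▸ hgcs i k τ
    have hP := hmax (asgSymP i k τ)
    have hM := hmax (asgSymM i k τ)
    constructor
    · refine le_antisymm hP (not_lt.1 fun hlt => ?_)
      nlinarith [mul_le_mul_of_nonneg_left hM (hg0 (asgSymP i k τ)), mul_lt_mul_of_pos_right hlt hGpos]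
    · refine le_antisymm hM (not_lt.1 fun hlt => ?_)
      nlinarith [mul_le_mul_of_nonneg_right hP (hg0 (asgSymM i k τ)), mul_lt_mul_of_pos_left hlt hGpos]
  -- the constant assignment with value `τm 0` is a maximiser, and there the ratio is `1`
  have hreach := good_const_of_asgSym_stable hN (Good := fun τ => g τ = g τm)
    (fun i k τ hτ => (hmaxPM i k τ hτ).1) (fun i k τ hτ => (hmaxPM i k τ hτ).2) rfl 0
  have hG : g τm = 1 := by rw [← hreach, hg1]
  have hσ : g σ ≤ 1 := hG ▸ hmax σ
  rw [hg] at hσ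
  exact (div_le_one (hD σ)).1 hσ

/-- **The chessboard estimate for label assignments** (Fröhlich–Israel–Lieb–Simon 1978, Thm. 4.1
(abstract chessboard estimate) / Thm. 4.3 (even torus); Biskup 2009 Thm. 5.8; Friedli–Velenik 2017
Thm. 10.11). On the block torus `(ℤ/N)^d` with `N` even and `d ≥ 1`, let `ψ` be a real functional of
label assignments `σ : BlockIdx d N → ι` ("the expectation of the product over blocks `c` of the
observable with label `σ c` in block `c`") such that for every direction `i` and block boundary `k`
both symmetrisations have non-negative value (reflection positivity) and
`ψ σ ^ 2 ≤ ψ (asgSymP i k σ) * ψ (asgSymM i k σ)` (reflection Cauchy–Schwarz). Then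
`|ψ σ| ^ (N^d) ≤ ∏_c ψ (const (σ c))`, i.e. `|ψ σ| ≤ ∏_c ‖σ c‖` with `‖a‖ = ψ (const a) ^ (1/N^d)`.
[cite: FrohlichIsraelLiebSimon1978, Thm 4.1] -/
theorem chessboard_abs_pow_le_prod_const (hd : 0 < d) (hN : Even N) (ψ : (BlockIdx d N → ι) → ℝ)
    (h : ∀ (i : Fin d) (k : ZMod N) (σ : BlockIdx d N → ι),
      0 ≤ ψ (asgSymP i k σ) ∧ 0 ≤ ψ (asgSymM i k σ) ∧
        ψ σ ^ 2 ≤ ψ (asgSymP i k σ) * ψ (asgSymM i k σ))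
    (σ : BlockIdx d N → ι) : |ψ σ| ^ (N ^ d) ≤ ∏ c, ψ (fun _ => σ c) := by
  -- a constant assignment is its own positive symmetrisation, hence `ψ ≥ 0` there
  have hγ0 : ∀ a : ι, 0 ≤ ψ (fun _ => a) := fun a => by
    have := (h ⟨0, hd⟩ 0 (fun _ => a)).1
    rwa [asgSymP_const] at this
  by_cases hpos : ∀ c, 0 < ψ (fun _ => σ c)
  · -- positive case: pull `ψ` back along `σ` to the finite label type `BlockIdx d N`
    have h' : ∀ (i : Fin d) (k : ZMod N) (τ : BlockIdx d N → BlockIdx d N),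
        0 ≤ ψ (σ ∘ asgSymP i k τ) ∧ 0 ≤ ψ (σ ∘ asgSymM i k τ) ∧
          ψ (σ ∘ τ) ^ 2 ≤ ψ (σ ∘ asgSymP i k τ) * ψ (σ ∘ asgSymM i k τ) := fun i k τ => by
      rw [← asgSymP_comp, ← asgSymM_comp]
      exact h i k (σ ∘ τ)
    exact chessboard_abs_pow_le_prod_const_of_pos hN (fun τ => ψ (σ ∘ τ)) h' hpos id
  · -- zero case
    obtain ⟨t₀, ht₀⟩ := not_forall.1 hpos
    have h0 : ψ (fun _ => σ t₀) = 0 := le_antisymm (not_lt.1 ht₀) (hγ0 _)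
    rw [chessboard_eq_zero_of_const_eq_zero hN (fun i k τ => (h i k τ).2.2) h0, abs_zero,
      zero_pow (pow_ne_zero _ (NeZero.ne N))]
    exact prod_nonneg fun c _ => hγ0 _

end Literature.Probability.LatticeModels

end
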